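/-
Copyright (c) 2026 the pub-hodgecm-mathlib formalisation cell (harness21).  Prover seat hodgecm-mathlib-LH4-p10 (g6): Track A «(D-RAM) FOUR-FRAME» squad of crux H413, STAGE-1b,
(L-sq) labelled trunk — dealer LH4-plan (g13) WORD #67 (2) «(T-box | sq)» (LH4-p12 (g7) SPEC `TBOX-SQ-SPEC.v1` ad5aa6ed §3), FILE 1∕2 «THE TRUNCATED TILING».  2026-09-04.
-/
import Summits.HodgeConjecture.HodgeConjecture.Theorems.F0P3cDyRamKappaCountBoxSumTiling   -- ★ (LH4-p14 (g3)): `leaf_T`, `leaf_Z`, `leaf_TT` and the untruncated `kappa_arith` (the twin proved here)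
import Summits.HodgeConjecture.HodgeConjecture.Theorems.F0P3cDyRamKappaCountBoxSumPlanes   -- ★ (LH4-p14 (g3)): `window_mul_eval`, `sum_glueWindow_reindex` (generic-bracket diagonal below)
import HarnessLib

/-!
# Crux `H413`, line LH4 «(D-RAM) FOUR-FRAME» — (L-sq) labelled trunk, brick (T-box | sq) FILE 1∕2: THE TRUNCATED TILING `SIGN·(x^{k−cs} − x^{k−max(cs,B)})`

Cell `hodgecm-mathlib` (D-0151), FLOOR 0, crux item H413 = `stmt-HodgeConjecture-24833`, route of record `HCCMUnconditional`; squad F0∕P3c∕LH4.  THEOREMS ONLY (pure finite-sum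
and exponent bookkeeping over `ℚ`; no `def`, no instance, no notation, no `sorry`, default heartbeats); lane `--supports stmt-HodgeConjecture-24833 --as helper` (count-neutral).

WHY.  LH4-p12 (g7)'s (T-box | sq) SPEC (`F0/P3c/LH4/LH4-p12/g7/tbox/TBOX-SQ-SPEC.v1.LH4p12g7.md` ad5aa6ed; 4116∕4116 numerically) asks for the twin of ★ p856906
`F0P3cDyRamKappaCountBoxSum.sum_box_kappa_eq_typeZero` (`(q − 1)·Σ_{box} κ-table = SIGN·(q^k − q^{k−B})`) for the κ-table of the square trunk CUT BY THE LABEL of record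
`Q M := LatticeInLevel ϖ (mstarOfRecord d) (diag e) M`: cells × [label kept].  Under the DERIVED FENCE `2d ≤ nⱼ + 1` (LH4-p12 (e1) `depths_ge_of_rootGuard`) the keep table of
SPEC §3 collapses to ONE rule on the cells that carry a non-zero κ-value: on-branch and tube cells are KEPT; a glue cell (foot `G_p(ρ,s)` or core-hanging `H(ρ)`) of level
`c = ⌈(2ρ − n′)∕2⌉` over a plane of depth `n′` is kept iff `2ρ ≤ 2n′ − m*`, i.e. iff `c ≤ U(n′) := (n′ + 1)∕2 − d` — the glue WINDOW `[max(1,L), C(n′)]`, `C(n′) = (n′ − d)∕2 + d%2`,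
loses exactly its top `cs(d) = ⌈d∕2⌉ = (d+1)∕2` entries (`C − U = cs`).  THIS FILE is the ARITHMETIC half: the truncated twin of ★ `…KappaCountBoxSumTiling.kappa_arith` —
given the evaluated blocks (foot blocks as in ★ `foot_mul_eval`, windows with top `min C U`), under the fence and the conductor side condition, the total is
`SIGN·(x^{k−cs} − x^{k − max(cs,B)})` (`2k + d = Σn + 2`, `2B = (n_i + 2(d%2) + 2 − 3d)⁺`): the tiling `[k − B, k − 1]` of ★ p856906 minus its top `cs` layers, DEAD when `B ≤ cs`
(the law `amplSq`'s `max(0, q^{k − cs d} − q^{k − B})`).  Companion tools: `window_mul_eval_trunc` (a two-sided window times `x − 1`) and `kappa_diag_sum_brk` (★ `kappa_diag_sum` with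
an arbitrary H bracket).  Proof device for the tilings: halve every depth (`d = 2e + δ`, `n = 2a + δ`, …) so that each branch of `split_ifs` is closed by a division-free `omega`.  FILE 2∕2 (the HEAD, typed against LH4-p12 (g7)'s named Prop `SqLabelledBoxSum`) reduces the labelled cell letters to these blocks with ★
`sum_box_eq_triple_sum` ∕ `triple_sum_eq_diag_add_planes` ∕ `kappa_plane_sum` (bracket `brk ∧ c ≤ U`).  Numerics: `blocks_trunc.py` (this seat, HOME `…/LH4-p10/g6/tbox/`): the
block identity on every fenced isoceles key d = 2..8, 16 depths, all slots — 1932∕1932; below the fence it FAILS (42∕1107: e.g. d = 2, (2,2,6), slot 2), so the fence is a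
hypothesis, not decoration.
HONEST LABEL.  Count-neutral; finite-sum bookkeeping, nothing printed is asserted, no lattice enters; pays no tier-0 row (T₊ ∕ T₋ ∕ regular OPEN; the labelled trunk `hTrunk` of ★
p859650 stays OPEN until (T-box | sq) FILE 2 + (T-asm) land); `HC_CM` is proved only modulo the 7 printed citations (2 remaining named inputs: hLiu418 = `stmt-HodgeConjecture-24832`,
h413 = `stmt-HodgeConjecture-24833`) until rung 0 closes.

## References
* [Kottwitz1986BaseChangeUnits] R. E. Kottwitz, *Base change for unit elements of Hecke algebras*, Compositio Math. 60 (1986), §1 pp. 240–241.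
* [Rogawski1990] J. D. Rogawski, *Automorphic Representations of Unitary Groups in Three Variables*, Ann. of Math. Stud. 123 (1990), §4.9 Prop. 4.9.1 (a) p. 55, §4.10 p. 58.
-/

set_option autoImplicit false

namespace Summit.HodgeConjecture.HodgeConjecture.Cruxes.H413.F0P3cDyRamKappaCountBoxSumTruncatedTiling

open Finset
open Summit.HodgeConjecture.HodgeConjecture.Cruxes.H413.F0P3cDyRamKappaCountBoxSumTiling (leaf_T leaf_Z leaf_TT)
open Summit.HodgeConjecture.HodgeConjecture.Cruxes.H413.F0P3cDyRamKappaCountBoxSumPlanes (window_mul_eval)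
open Summit.HodgeConjecture.HodgeConjecture.Cruxes.H413.F0P3cDyRamKappaCountBoxSumBlocks (sum_glueWindow_reindex)

section Tools

variable {R : Type*} [CommRing R]

/-- **A TWO-SIDED WINDOW TIMES `x − 1`**: for a bracket `P ↔ (L ≤ ·)` and a cut `U ≤ C`, `(x − 1)·Σ_{1 ≤ c ≤ C} [P c ∧ c ≤ U]·x^{A+c} = [max 1 L ≤ U]·(x^{A + U + 1} − x^{A + max 1 L})` —
★ `window_mul_eval` on the range cut at `U`. [folklore] -/
theorem window_mul_eval_trunc (x : R) (A L C U : ℕ) (hUC : U ≤ C) (P : ℕ → Prop) [DecidablePred P] (hP : ∀ c, P c ↔ L ≤ c) :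
    (x - 1) * ∑ c ∈ Icc 1 C, (if P c ∧ c ≤ U then x ^ (A + c) else 0) =
      if max 1 L ≤ U then x ^ (A + U + 1) - x ^ (A + max 1 L) else 0 := by
  rw [← window_mul_eval x A L U]
  congr 1
  rw [← Finset.sum_filter, ← Finset.sum_filter]
  refine Finset.sum_congr ?_ fun _ _ => rfl
  ext c
  simp only [Finset.mem_filter, Finset.mem_Icc, hP c]
  constructor
  · rintro ⟨⟨h1, -⟩, h3, h4⟩; exact ⟨⟨h1, h4⟩, h3⟩
  · rintro ⟨⟨h1, h4⟩, h3⟩; exact ⟨⟨h1, le_trans h4 hUC⟩, h3, h4⟩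

/-- **THE DIAGONAL OF THE κ-TABLE WITH AN ARBITRARY H BRACKET** (★ `kappa_diag_sum` is the case `brk c := d ≤ c`): `ψ 0 = 0`, odd `r` zero, `ψ(2ρ)` = the equilateral H-glue
cell bracketed by `brk ⌈(2ρ−m)/2⌉`; the diagonal sum is `εH·Σ_{1 ≤ c ≤ (m−d)/2 + d%2} [brk c]·x^{2⌊m/2⌋ + c}` (present iff the key is equilateral). [folklore] -/
theorem kappa_diag_sum_brk (x εH : R) (e1 e2 : Prop) [Decidable e1] [Decidable e2] (brk : ℕ → Prop) [DecidablePred brk] {d m B : ℕ} (hdm : d ≤ m) (hpar : m % 2 = d % 2)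
    (hB : e1 → e2 → 2 * m ≤ B) (ψ : ℕ → R) (h0 : ψ 0 = 0)
    (hH : ∀ ρ, 1 ≤ ρ → ψ (2 * ρ) = if e1 ∧ e2 ∧ m < 2 * ρ ∧ 2 * ρ - m ≤ m - d + 1 ∧ brk ((2 * ρ - m + 1) / 2) then εH * x ^ (2 * ρ - (2 * ρ - m + 1) / 2) else 0)
    (hZ : ∀ r, 1 ≤ r → ¬ 2 ∣ r → ψ r = 0) :
    ∑ r ∈ range (B + 1), ψ r = if e1 ∧ e2 then εH * ∑ c ∈ Icc 1 ((m - d) / 2 + d % 2), (if brk c then x ^ (2 * (m / 2) + c) else 0) else 0 := by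
  by_cases he : e1 ∧ e2
  · rw [if_pos he]
    have hpt : ∀ r, ψ r = if 2 ∣ r ∧ m < r ∧ r - m ≤ m - d + 1 then (if brk ((r - m + 1) / 2) then εH * x ^ (r - (r - m + 1) / 2) else 0) else 0 := by
      intro r
      rcases Nat.eq_zero_or_pos r with rfl | hr
      · rw [h0, if_neg (fun h => by omega)]
      · by_cases hr2 : 2 ∣ r
        · obtain ⟨ρ, rfl⟩ : ∃ ρ, r = 2 * ρ := ⟨r / 2, by omega⟩
          rw [hH ρ (by omega)]
          simp only [he.1, he.2, true_and]
          split_ifs <;> first | rfl | (exfalso; omega) | tauto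
        · rw [hZ r hr hr2, if_neg (fun h => hr2 h.1)]
    simp only [hpt]
    rw [sum_glueWindow_reindex (fun c e => if brk c then εH * x ^ e else 0) hpar hdm (hB he.1 he.2), Finset.mul_sum]
    refine Finset.sum_congr rfl fun c _ => ?_
    by_cases hb : brk c
    · rw [if_pos hb, if_pos hb]
    · rw [if_neg hb, if_neg hb, mul_zero]
  · rw [if_neg he]
    refine Finset.sum_eq_zero fun r _ => ?_
    rcases Nat.eq_zero_or_pos r with rfl | hr
    · exact h0
    · by_cases hr2 : 2 ∣ r
      · obtain ⟨ρ, rfl⟩ : ∃ ρ, r = 2 * ρ := ⟨r / 2, by omega⟩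
        rw [hH ρ (by omega), if_neg (fun h => he ⟨h.1, h.2.1⟩)]
      · exact hZ r hr hr2

end Tools

section Tiling

/-- The truncated tiling, strict apex `2` (legs `n₁`, apex `n₃`): fenced block values with windows cut at `U = (n′+1)/2 − d` ⟹ `SIGN·(x^(k−cs) − x^(k − max cs B))`. [folklore] -/
theorem kappa_arith_trunc_apex2 (x ω εH : ℚ) (εG : Fin 3 → Fin 3 → ℚ) {d n₁ n₃ k : ℕ} (hd : 2 ≤ d) (hlt : n₁ < n₃) (hdn : d ≤ n₁)
    (hl : n₁ % 2 = d % 2) (ha : n₃ % 2 = d % 2) (hk : 2 * k + d = n₁ + n₁ + n₃ + 2) (hf1 : 2 * d ≤ n₁ + 1) (hf3 : 2 * d ≤ n₃ + 1) (i : Fin 3)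
    (hω : i = 2 → n₁ + 2 * d ≤ n₃ → εG 2 2 = ω) :
    (if n₁ = n₁ ∧ n₁ = n₃ then εH * (if max 1 d ≤ (n₁ + 1) / 2 - d then x ^ (2 * (n₁ / 2) + ((n₁ + 1) / 2 - d) + 1) - x ^ (2 * (n₁ / 2) + max 1 d) else 0) else 0) +
          ((if i = 0 then (if min n₁ n₃ / 2 + d ≤ n₁ / 2 then ω * (x ^ (n₁ / 2 + min n₁ n₃ / 2 + 1) - x ^ (2 * (min n₁ n₃ / 2) + d)) else 0) else 0) +
            (if n₁ = n₃ ∧ n₁ < n₁ ∧ (n₁ - n₁) % 2 = 0 then εG 0 i * (if max 1 (if i = 0 then d - (n₁ - n₁) / 2 else d) ≤ (n₁ + 1) / 2 - d then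
              x ^ (2 * (n₁ / 2) + (n₁ - n₁) / 2 + ((n₁ + 1) / 2 - d) + 1) - x ^ (2 * (n₁ / 2) + (n₁ - n₁) / 2 + max 1 (if i = 0 then d - (n₁ - n₁) / 2 else d)) else 0) else 0)) +
          ((if i = 1 then (if min n₁ n₃ / 2 + d ≤ n₁ / 2 then ω * (x ^ (n₁ / 2 + min n₁ n₃ / 2 + 1) - x ^ (2 * (min n₁ n₃ / 2) + d)) else 0) else 0) +
            (if n₁ = n₃ ∧ n₁ < n₁ ∧ (n₁ - n₁) % 2 = 0 then εG 1 i * (if max 1 (if i = 1 then d - (n₁ - n₁) / 2 else d) ≤ (n₁ + 1) / 2 - d then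
              x ^ (2 * (n₁ / 2) + (n₁ - n₁) / 2 + ((n₁ + 1) / 2 - d) + 1) - x ^ (2 * (n₁ / 2) + (n₁ - n₁) / 2 + max 1 (if i = 1 then d - (n₁ - n₁) / 2 else d)) else 0) else 0)) +
          ((if i = 2 then (if min n₁ n₁ / 2 + d ≤ n₃ / 2 then ω * (x ^ (n₃ / 2 + min n₁ n₁ / 2 + 1) - x ^ (2 * (min n₁ n₁ / 2) + d)) else 0) else 0) +
            (if n₁ = n₁ ∧ n₁ < n₃ ∧ (n₃ - n₁) % 2 = 0 then εG 2 i * (if max 1 (if i = 2 then d - (n₃ - n₁) / 2 else d) ≤ (n₁ + 1) / 2 - d then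
              x ^ (2 * (n₁ / 2) + (n₃ - n₁) / 2 + ((n₁ + 1) / 2 - d) + 1) - x ^ (2 * (n₁ / 2) + (n₃ - n₁) / 2 + max 1 (if i = 2 then d - (n₃ - n₁) / 2 else d)) else 0) else 0))
      = (if n₁ = n₁ ∧ n₁ = n₃ then εH else if n₁ = n₃ then εG 0 i else if n₁ = n₃ then εG 1 i else εG 2 i) *
        (x ^ (k - (d + 1) / 2) - x ^ (k - max ((d + 1) / 2) (((![n₁, n₁, n₃] : Fin 3 → ℕ) i + 2 * (d % 2) + 2 - 3 * d) / 2))) := by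
  obtain ⟨δ, e, hδ, rfl⟩ : ∃ δ e, δ ≤ 1 ∧ d = 2 * e + δ := ⟨d % 2, d / 2, by omega, by omega⟩
  obtain ⟨a, rfl⟩ : ∃ a, n₁ = 2 * a + δ := ⟨n₁ / 2, by omega⟩
  obtain ⟨b, rfl⟩ : ∃ b, n₃ = 2 * b + δ := ⟨n₃ / 2, by omega⟩
  have r1 : (2 * e + δ) % 2 = δ := by omega
  have r2 : (2 * a + δ) / 2 = a := by omega
  have r3 : (2 * b + δ) / 2 = b := by omega
  have r4 : (2 * a + δ + 1) / 2 - (2 * e + δ) = a + δ - (2 * e + δ) := by omega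
  have r5 : (2 * b + δ - (2 * a + δ)) / 2 = b - a := by omega
  have r6 : (2 * e + δ + 1) / 2 = e + δ := by omega
  have r7 : (2 * a + δ + 2 * δ + 2 - 3 * (2 * e + δ)) / 2 = a + 1 - 3 * e := by omega
  have r8 : (2 * b + δ + 2 * δ + 2 - 3 * (2 * e + δ)) / 2 = b + 1 - 3 * e := by omega
  have hne0 : ¬ (2 * a + δ = 2 * b + δ) := by omega
  have hlt' : 2 * a + δ < 2 * b + δ := by omega
  have hpar : (2 * b + δ - (2 * a + δ)) % 2 = 0 := by omega
  simp only [hne0, hlt', hpar, min_eq_left hlt'.le, and_true, false_and, and_false, ↓reduceIte, zero_add, add_zero, lt_self_iff_false, min_self,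
    r1, r2, r3, r4, r5, r6]
  fin_cases i <;> simp only [Fin.zero_eta, Fin.mk_one, Fin.reduceFinMk, Fin.isValue, Fin.reduceEq, ↓reduceIte, Matrix.cons_val_zero, Matrix.cons_val_one, Matrix.cons_val_two,
    Matrix.head_cons, Matrix.tail_cons, add_zero, zero_add, r7, r8] <;> clear r1 r2 r3 r4 r5 r6 r7 r8 hl ha
  · split_ifs <;> (try simp only [mul_zero, add_zero, zero_add]) <;> first | exact leaf_TT (by omega) (by omega) (by omega) | exact leaf_T (by omega) (by omega) | exact leaf_Z (by omega) | (exfalso; omega)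
  · split_ifs <;> (try simp only [mul_zero, add_zero, zero_add]) <;> first | exact leaf_TT (by omega) (by omega) (by omega) | exact leaf_T (by omega) (by omega) | exact leaf_Z (by omega) | (exfalso; omega)
  · by_cases hdeep : 2 * a + δ + 2 * (2 * e + δ) ≤ 2 * b + δ
    · rw [hω rfl hdeep]
      split_ifs <;> (try simp only [mul_zero, add_zero, zero_add]) <;> first | exact leaf_TT (by omega) (by omega) (by omega) | exact leaf_T (by omega) (by omega) | exact leaf_Z (by omega)
    · split_ifs <;> (try simp only [mul_zero, add_zero, zero_add]) <;> first | exact leaf_TT (by omega) (by omega) (by omega) | exact leaf_T (by omega) (by omega) | exact leaf_Z (by omega) | (exfalso; omega)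

/-- The truncated tiling, strict apex `1` (legs `n₁`, apex `n₂`). [folklore] -/
theorem kappa_arith_trunc_apex1 (x ω εH : ℚ) (εG : Fin 3 → Fin 3 → ℚ) {d n₁ n₂ k : ℕ} (hd : 2 ≤ d) (hlt : n₁ < n₂) (hdn : d ≤ n₁)
    (hl : n₁ % 2 = d % 2) (ha : n₂ % 2 = d % 2) (hk : 2 * k + d = n₁ + n₂ + n₁ + 2) (hf1 : 2 * d ≤ n₁ + 1) (hf2 : 2 * d ≤ n₂ + 1) (i : Fin 3)
    (hω : i = 1 → n₁ + 2 * d ≤ n₂ → εG 1 1 = ω) :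
    (if n₁ = n₂ ∧ n₂ = n₁ then εH * (if max 1 d ≤ (n₁ + 1) / 2 - d then x ^ (2 * (n₁ / 2) + ((n₁ + 1) / 2 - d) + 1) - x ^ (2 * (n₁ / 2) + max 1 d) else 0) else 0) +
          ((if i = 0 then (if min n₂ n₁ / 2 + d ≤ n₁ / 2 then ω * (x ^ (n₁ / 2 + min n₂ n₁ / 2 + 1) - x ^ (2 * (min n₂ n₁ / 2) + d)) else 0) else 0) +
            (if n₂ = n₁ ∧ n₂ < n₁ ∧ (n₁ - n₂) % 2 = 0 then εG 0 i * (if max 1 (if i = 0 then d - (n₁ - n₂) / 2 else d) ≤ (n₂ + 1) / 2 - d then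
              x ^ (2 * (n₂ / 2) + (n₁ - n₂) / 2 + ((n₂ + 1) / 2 - d) + 1) - x ^ (2 * (n₂ / 2) + (n₁ - n₂) / 2 + max 1 (if i = 0 then d - (n₁ - n₂) / 2 else d)) else 0) else 0)) +
          ((if i = 1 then (if min n₁ n₁ / 2 + d ≤ n₂ / 2 then ω * (x ^ (n₂ / 2 + min n₁ n₁ / 2 + 1) - x ^ (2 * (min n₁ n₁ / 2) + d)) else 0) else 0) +
            (if n₁ = n₁ ∧ n₁ < n₂ ∧ (n₂ - n₁) % 2 = 0 then εG 1 i * (if max 1 (if i = 1 then d - (n₂ - n₁) / 2 else d) ≤ (n₁ + 1) / 2 - d then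
              x ^ (2 * (n₁ / 2) + (n₂ - n₁) / 2 + ((n₁ + 1) / 2 - d) + 1) - x ^ (2 * (n₁ / 2) + (n₂ - n₁) / 2 + max 1 (if i = 1 then d - (n₂ - n₁) / 2 else d)) else 0) else 0)) +
          ((if i = 2 then (if min n₁ n₂ / 2 + d ≤ n₁ / 2 then ω * (x ^ (n₁ / 2 + min n₁ n₂ / 2 + 1) - x ^ (2 * (min n₁ n₂ / 2) + d)) else 0) else 0) +
            (if n₁ = n₂ ∧ n₁ < n₁ ∧ (n₁ - n₁) % 2 = 0 then εG 2 i * (if max 1 (if i = 2 then d - (n₁ - n₁) / 2 else d) ≤ (n₁ + 1) / 2 - d then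
              x ^ (2 * (n₁ / 2) + (n₁ - n₁) / 2 + ((n₁ + 1) / 2 - d) + 1) - x ^ (2 * (n₁ / 2) + (n₁ - n₁) / 2 + max 1 (if i = 2 then d - (n₁ - n₁) / 2 else d)) else 0) else 0))
      = (if n₁ = n₂ ∧ n₂ = n₁ then εH else if n₂ = n₁ then εG 0 i else if n₁ = n₁ then εG 1 i else εG 2 i) *
        (x ^ (k - (d + 1) / 2) - x ^ (k - max ((d + 1) / 2) (((![n₁, n₂, n₁] : Fin 3 → ℕ) i + 2 * (d % 2) + 2 - 3 * d) / 2))) := by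
  obtain ⟨δ, e, hδ, rfl⟩ : ∃ δ e, δ ≤ 1 ∧ d = 2 * e + δ := ⟨d % 2, d / 2, by omega, by omega⟩
  obtain ⟨a, rfl⟩ : ∃ a, n₁ = 2 * a + δ := ⟨n₁ / 2, by omega⟩
  obtain ⟨b, rfl⟩ : ∃ b, n₂ = 2 * b + δ := ⟨n₂ / 2, by omega⟩
  have r1 : (2 * e + δ) % 2 = δ := by omega
  have r2 : (2 * a + δ) / 2 = a := by omega
  have r3 : (2 * b + δ) / 2 = b := by omega
  have r4 : (2 * a + δ + 1) / 2 - (2 * e + δ) = a + δ - (2 * e + δ) := by omega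
  have r5 : (2 * b + δ - (2 * a + δ)) / 2 = b - a := by omega
  have r6 : (2 * e + δ + 1) / 2 = e + δ := by omega
  have r7 : (2 * a + δ + 2 * δ + 2 - 3 * (2 * e + δ)) / 2 = a + 1 - 3 * e := by omega
  have r8 : (2 * b + δ + 2 * δ + 2 - 3 * (2 * e + δ)) / 2 = b + 1 - 3 * e := by omega
  have hne0 : ¬ (2 * a + δ = 2 * b + δ) := by omega
  have hlt' : 2 * a + δ < 2 * b + δ := by omega
  have hpar : (2 * b + δ - (2 * a + δ)) % 2 = 0 := by omega
  have hne1 : ¬ (2 * b + δ = 2 * a + δ) := by omega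
  simp only [hne0, hne1, hlt', hpar, min_eq_right hlt'.le, min_eq_left hlt'.le, and_true, false_and, and_false, ↓reduceIte, zero_add, add_zero, lt_self_iff_false, min_self,
    r1, r2, r3, r4, r5, r6]
  fin_cases i <;> simp only [Fin.zero_eta, Fin.mk_one, Fin.reduceFinMk, Fin.isValue, Fin.reduceEq, ↓reduceIte, Matrix.cons_val_zero, Matrix.cons_val_one, Matrix.cons_val_two,
    Matrix.head_cons, Matrix.tail_cons, add_zero, zero_add, r7, r8] <;> clear r1 r2 r3 r4 r5 r6 r7 r8 hl ha
  · split_ifs <;> (try simp only [mul_zero, add_zero, zero_add]) <;> first | exact leaf_TT (by omega) (by omega) (by omega) | exact leaf_T (by omega) (by omega) | exact leaf_Z (by omega) | (exfalso; omega)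
  · by_cases hdeep : 2 * a + δ + 2 * (2 * e + δ) ≤ 2 * b + δ
    · rw [hω rfl hdeep]
      split_ifs <;> (try simp only [mul_zero, add_zero, zero_add]) <;> first | exact leaf_TT (by omega) (by omega) (by omega) | exact leaf_T (by omega) (by omega) | exact leaf_Z (by omega)
    · split_ifs <;> (try simp only [mul_zero, add_zero, zero_add]) <;> first | exact leaf_TT (by omega) (by omega) (by omega) | exact leaf_T (by omega) (by omega) | exact leaf_Z (by omega) | (exfalso; omega)
  · split_ifs <;> (try simp only [mul_zero, add_zero, zero_add]) <;> first | exact leaf_TT (by omega) (by omega) (by omega) | exact leaf_T (by omega) (by omega) | exact leaf_Z (by omega) | (exfalso; omega)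

/-- The truncated tiling, strict apex `0` (legs `n₂`, apex `n₁`). [folklore] -/
theorem kappa_arith_trunc_apex0 (x ω εH : ℚ) (εG : Fin 3 → Fin 3 → ℚ) {d n₂ n₁ k : ℕ} (hd : 2 ≤ d) (hlt : n₂ < n₁) (hdn : d ≤ n₂)
    (hl : n₂ % 2 = d % 2) (ha : n₁ % 2 = d % 2) (hk : 2 * k + d = n₁ + n₂ + n₂ + 2) (hf2 : 2 * d ≤ n₂ + 1) (hf1 : 2 * d ≤ n₁ + 1) (i : Fin 3)
    (hω : i = 0 → n₂ + 2 * d ≤ n₁ → εG 0 0 = ω) :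
    (if n₁ = n₂ ∧ n₂ = n₂ then εH * (if max 1 d ≤ (n₁ + 1) / 2 - d then x ^ (2 * (n₁ / 2) + ((n₁ + 1) / 2 - d) + 1) - x ^ (2 * (n₁ / 2) + max 1 d) else 0) else 0) +
          ((if i = 0 then (if min n₂ n₂ / 2 + d ≤ n₁ / 2 then ω * (x ^ (n₁ / 2 + min n₂ n₂ / 2 + 1) - x ^ (2 * (min n₂ n₂ / 2) + d)) else 0) else 0) +
            (if n₂ = n₂ ∧ n₂ < n₁ ∧ (n₁ - n₂) % 2 = 0 then εG 0 i * (if max 1 (if i = 0 then d - (n₁ - n₂) / 2 else d) ≤ (n₂ + 1) / 2 - d then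
              x ^ (2 * (n₂ / 2) + (n₁ - n₂) / 2 + ((n₂ + 1) / 2 - d) + 1) - x ^ (2 * (n₂ / 2) + (n₁ - n₂) / 2 + max 1 (if i = 0 then d - (n₁ - n₂) / 2 else d)) else 0) else 0)) +
          ((if i = 1 then (if min n₁ n₂ / 2 + d ≤ n₂ / 2 then ω * (x ^ (n₂ / 2 + min n₁ n₂ / 2 + 1) - x ^ (2 * (min n₁ n₂ / 2) + d)) else 0) else 0) +
            (if n₁ = n₂ ∧ n₁ < n₂ ∧ (n₂ - n₁) % 2 = 0 then εG 1 i * (if max 1 (if i = 1 then d - (n₂ - n₁) / 2 else d) ≤ (n₁ + 1) / 2 - d then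
              x ^ (2 * (n₁ / 2) + (n₂ - n₁) / 2 + ((n₁ + 1) / 2 - d) + 1) - x ^ (2 * (n₁ / 2) + (n₂ - n₁) / 2 + max 1 (if i = 1 then d - (n₂ - n₁) / 2 else d)) else 0) else 0)) +
          ((if i = 2 then (if min n₁ n₂ / 2 + d ≤ n₂ / 2 then ω * (x ^ (n₂ / 2 + min n₁ n₂ / 2 + 1) - x ^ (2 * (min n₁ n₂ / 2) + d)) else 0) else 0) +
            (if n₁ = n₂ ∧ n₁ < n₂ ∧ (n₂ - n₁) % 2 = 0 then εG 2 i * (if max 1 (if i = 2 then d - (n₂ - n₁) / 2 else d) ≤ (n₁ + 1) / 2 - d then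
              x ^ (2 * (n₁ / 2) + (n₂ - n₁) / 2 + ((n₁ + 1) / 2 - d) + 1) - x ^ (2 * (n₁ / 2) + (n₂ - n₁) / 2 + max 1 (if i = 2 then d - (n₂ - n₁) / 2 else d)) else 0) else 0))
      = (if n₁ = n₂ ∧ n₂ = n₂ then εH else if n₂ = n₂ then εG 0 i else if n₁ = n₂ then εG 1 i else εG 2 i) *
        (x ^ (k - (d + 1) / 2) - x ^ (k - max ((d + 1) / 2) (((![n₁, n₂, n₂] : Fin 3 → ℕ) i + 2 * (d % 2) + 2 - 3 * d) / 2))) := by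
  obtain ⟨δ, e, hδ, rfl⟩ : ∃ δ e, δ ≤ 1 ∧ d = 2 * e + δ := ⟨d % 2, d / 2, by omega, by omega⟩
  obtain ⟨a, rfl⟩ : ∃ a, n₂ = 2 * a + δ := ⟨n₂ / 2, by omega⟩
  obtain ⟨b, rfl⟩ : ∃ b, n₁ = 2 * b + δ := ⟨n₁ / 2, by omega⟩
  have r1 : (2 * e + δ) % 2 = δ := by omega
  have r2 : (2 * a + δ) / 2 = a := by omega
  have r3 : (2 * b + δ) / 2 = b := by omega
  have r4 : (2 * a + δ + 1) / 2 - (2 * e + δ) = a + δ - (2 * e + δ) := by omega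
  have r5 : (2 * b + δ - (2 * a + δ)) / 2 = b - a := by omega
  have r6 : (2 * e + δ + 1) / 2 = e + δ := by omega
  have r7 : (2 * a + δ + 2 * δ + 2 - 3 * (2 * e + δ)) / 2 = a + 1 - 3 * e := by omega
  have r8 : (2 * b + δ + 2 * δ + 2 - 3 * (2 * e + δ)) / 2 = b + 1 - 3 * e := by omega
  have hne0 : ¬ (2 * b + δ = 2 * a + δ) := by omega
  have hlt' : 2 * a + δ < 2 * b + δ := by omega
  have hpar : (2 * b + δ - (2 * a + δ)) % 2 = 0 := by omega
  simp only [hne0, hlt', hpar, min_eq_right hlt'.le, and_true, false_and, ↓reduceIte, zero_add, add_zero, min_self,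
    r1, r2, r3, r4, r5, r6]
  fin_cases i <;> simp only [Fin.zero_eta, Fin.mk_one, Fin.reduceFinMk, Fin.isValue, Fin.reduceEq, ↓reduceIte, Matrix.cons_val_zero, Matrix.cons_val_one, Matrix.cons_val_two,
    Matrix.head_cons, Matrix.tail_cons, add_zero, zero_add, r7, r8] <;> clear r1 r2 r3 r4 r5 r6 r7 r8 hl ha
  · by_cases hdeep : 2 * a + δ + 2 * (2 * e + δ) ≤ 2 * b + δ
    · rw [hω rfl hdeep]
      split_ifs <;> (try simp only [mul_zero, add_zero, zero_add]) <;> first | exact leaf_TT (by omega) (by omega) (by omega) | exact leaf_T (by omega) (by omega) | exact leaf_Z (by omega)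
    · split_ifs <;> (try simp only [mul_zero, add_zero, zero_add]) <;> first | exact leaf_TT (by omega) (by omega) (by omega) | exact leaf_T (by omega) (by omega) | exact leaf_Z (by omega) | (exfalso; omega)
  · split_ifs <;> (try simp only [mul_zero, add_zero, zero_add]) <;> first | exact leaf_TT (by omega) (by omega) (by omega) | exact leaf_T (by omega) (by omega) | exact leaf_Z (by omega) | (exfalso; omega)
  · split_ifs <;> (try simp only [mul_zero, add_zero, zero_add]) <;> first | exact leaf_TT (by omega) (by omega) (by omega) | exact leaf_T (by omega) (by omega) | exact leaf_Z (by omega) | (exfalso; omega)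

/-- The truncated tiling, equilateral key: only the (cut) H window is alive. [folklore] -/
theorem kappa_arith_trunc_equi (x ω εH : ℚ) (εG : Fin 3 → Fin 3 → ℚ) {d n₁ k : ℕ} (hd : 2 ≤ d) (hdn : d ≤ n₁) (hl : n₁ % 2 = d % 2)
    (hk : 2 * k + d = n₁ + n₁ + n₁ + 2) (hf1 : 2 * d ≤ n₁ + 1) (i : Fin 3) :
    (if n₁ = n₁ ∧ n₁ = n₁ then εH * (if max 1 d ≤ (n₁ + 1) / 2 - d then x ^ (2 * (n₁ / 2) + ((n₁ + 1) / 2 - d) + 1) - x ^ (2 * (n₁ / 2) + max 1 d) else 0) else 0) +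
          ((if i = 0 then (if min n₁ n₁ / 2 + d ≤ n₁ / 2 then ω * (x ^ (n₁ / 2 + min n₁ n₁ / 2 + 1) - x ^ (2 * (min n₁ n₁ / 2) + d)) else 0) else 0) +
            (if n₁ = n₁ ∧ n₁ < n₁ ∧ (n₁ - n₁) % 2 = 0 then εG 0 i * (if max 1 (if i = 0 then d - (n₁ - n₁) / 2 else d) ≤ (n₁ + 1) / 2 - d then
              x ^ (2 * (n₁ / 2) + (n₁ - n₁) / 2 + ((n₁ + 1) / 2 - d) + 1) - x ^ (2 * (n₁ / 2) + (n₁ - n₁) / 2 + max 1 (if i = 0 then d - (n₁ - n₁) / 2 else d)) else 0) else 0)) +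
          ((if i = 1 then (if min n₁ n₁ / 2 + d ≤ n₁ / 2 then ω * (x ^ (n₁ / 2 + min n₁ n₁ / 2 + 1) - x ^ (2 * (min n₁ n₁ / 2) + d)) else 0) else 0) +
            (if n₁ = n₁ ∧ n₁ < n₁ ∧ (n₁ - n₁) % 2 = 0 then εG 1 i * (if max 1 (if i = 1 then d - (n₁ - n₁) / 2 else d) ≤ (n₁ + 1) / 2 - d then
              x ^ (2 * (n₁ / 2) + (n₁ - n₁) / 2 + ((n₁ + 1) / 2 - d) + 1) - x ^ (2 * (n₁ / 2) + (n₁ - n₁) / 2 + max 1 (if i = 1 then d - (n₁ - n₁) / 2 else d)) else 0) else 0)) +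
          ((if i = 2 then (if min n₁ n₁ / 2 + d ≤ n₁ / 2 then ω * (x ^ (n₁ / 2 + min n₁ n₁ / 2 + 1) - x ^ (2 * (min n₁ n₁ / 2) + d)) else 0) else 0) +
            (if n₁ = n₁ ∧ n₁ < n₁ ∧ (n₁ - n₁) % 2 = 0 then εG 2 i * (if max 1 (if i = 2 then d - (n₁ - n₁) / 2 else d) ≤ (n₁ + 1) / 2 - d then
              x ^ (2 * (n₁ / 2) + (n₁ - n₁) / 2 + ((n₁ + 1) / 2 - d) + 1) - x ^ (2 * (n₁ / 2) + (n₁ - n₁) / 2 + max 1 (if i = 2 then d - (n₁ - n₁) / 2 else d)) else 0) else 0))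
      = (if n₁ = n₁ ∧ n₁ = n₁ then εH else if n₁ = n₁ then εG 0 i else if n₁ = n₁ then εG 1 i else εG 2 i) *
        (x ^ (k - (d + 1) / 2) - x ^ (k - max ((d + 1) / 2) (((![n₁, n₁, n₁] : Fin 3 → ℕ) i + 2 * (d % 2) + 2 - 3 * d) / 2))) := by
  obtain ⟨δ, e, hδ, rfl⟩ : ∃ δ e, δ ≤ 1 ∧ d = 2 * e + δ := ⟨d % 2, d / 2, by omega, by omega⟩
  obtain ⟨a, rfl⟩ : ∃ a, n₁ = 2 * a + δ := ⟨n₁ / 2, by omega⟩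
  have r1 : (2 * e + δ) % 2 = δ := by omega
  have r2 : (2 * a + δ) / 2 = a := by omega
  have r4 : (2 * a + δ + 1) / 2 - (2 * e + δ) = a + δ - (2 * e + δ) := by omega
  have r6 : (2 * e + δ + 1) / 2 = e + δ := by omega
  have r7 : (2 * a + δ + 2 * δ + 2 - 3 * (2 * e + δ)) / 2 = a + 1 - 3 * e := by omega
  simp only [and_true, false_and, and_false, ↓reduceIte, add_zero, lt_self_iff_false, min_self, r1, r2, r4, r6]
  fin_cases i <;> simp only [Fin.zero_eta, Fin.mk_one, Fin.reduceFinMk, Fin.isValue, Fin.reduceEq, ↓reduceIte, Matrix.cons_val_zero, Matrix.cons_val_one, Matrix.cons_val_two,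
    Matrix.head_cons, Matrix.tail_cons, add_zero, r7] <;> clear r1 r2 r4 r6 r7 hl <;> split_ifs <;> (try simp only [mul_zero, add_zero, zero_add]) <;> first | exact leaf_TT (by omega) (by omega) (by omega) | exact leaf_T (by omega) (by omega) | exact leaf_Z (by omega) | (exfalso; omega)

/-- **THE TRUNCATED TILING** for an isoceles key under the fence `2d ≤ nⱼ + 1` (dispatch on the orientation): the evaluated blocks of the LABELLED κ-table — foot blocks
untouched (★ `foot_mul_eval`), glue ∕ H windows cut at `U(n′) = (n′+1)/2 − d` (`window_mul_eval_trunc` ∕ `kappa_diag_sum_brk`, their top `cs = (d+1)/2` entries killed) — total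
`SIGN·(x^(k−cs) − x^(k − max cs B))`, `2k + d = Σn + 2`, `B = (n_i + 2(d%2) + 2 − 3d)⁺/2`: the tiling `[k − B, k − 1]` of ★ `kappa_arith` minus its top `cs` layers. [folklore] -/
theorem kappa_arith_trunc (x ω εH : ℚ) (εG : Fin 3 → Fin 3 → ℚ) {d n₁ n₂ n₃ k : ℕ} (hd : 2 ≤ d)
    (hiso : (n₁ = n₂ ∧ n₁ ≤ n₃) ∨ (n₁ = n₃ ∧ n₁ ≤ n₂) ∨ (n₂ = n₃ ∧ n₂ ≤ n₁))
    (hdn : d ≤ min n₁ (min n₂ n₃)) (h1 : n₁ % 2 = d % 2) (h2 : n₂ % 2 = d % 2) (h3 : n₃ % 2 = d % 2)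
    (hk : 2 * k + d = n₁ + n₂ + n₃ + 2) (hf1 : 2 * d ≤ n₁ + 1) (hf2 : 2 * d ≤ n₂ + 1) (hf3 : 2 * d ≤ n₃ + 1) (i : Fin 3)
    (hω0 : i = 0 → n₂ = n₃ → n₂ + 2 * d ≤ n₁ → εG 0 0 = ω) (hω1 : i = 1 → n₁ = n₃ → n₁ + 2 * d ≤ n₂ → εG 1 1 = ω)
    (hω2 : i = 2 → n₁ = n₂ → n₁ + 2 * d ≤ n₃ → εG 2 2 = ω) :
    (if n₁ = n₂ ∧ n₂ = n₃ then εH * (if max 1 d ≤ (n₁ + 1) / 2 - d then x ^ (2 * (n₁ / 2) + ((n₁ + 1) / 2 - d) + 1) - x ^ (2 * (n₁ / 2) + max 1 d) else 0) else 0) +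
          ((if i = 0 then (if min n₂ n₃ / 2 + d ≤ n₁ / 2 then ω * (x ^ (n₁ / 2 + min n₂ n₃ / 2 + 1) - x ^ (2 * (min n₂ n₃ / 2) + d)) else 0) else 0) +
            (if n₂ = n₃ ∧ n₂ < n₁ ∧ (n₁ - n₂) % 2 = 0 then εG 0 i * (if max 1 (if i = 0 then d - (n₁ - n₂) / 2 else d) ≤ (n₂ + 1) / 2 - d then
              x ^ (2 * (n₂ / 2) + (n₁ - n₂) / 2 + ((n₂ + 1) / 2 - d) + 1) - x ^ (2 * (n₂ / 2) + (n₁ - n₂) / 2 + max 1 (if i = 0 then d - (n₁ - n₂) / 2 else d)) else 0) else 0)) +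
          ((if i = 1 then (if min n₁ n₃ / 2 + d ≤ n₂ / 2 then ω * (x ^ (n₂ / 2 + min n₁ n₃ / 2 + 1) - x ^ (2 * (min n₁ n₃ / 2) + d)) else 0) else 0) +
            (if n₁ = n₃ ∧ n₁ < n₂ ∧ (n₂ - n₁) % 2 = 0 then εG 1 i * (if max 1 (if i = 1 then d - (n₂ - n₁) / 2 else d) ≤ (n₁ + 1) / 2 - d then
              x ^ (2 * (n₁ / 2) + (n₂ - n₁) / 2 + ((n₁ + 1) / 2 - d) + 1) - x ^ (2 * (n₁ / 2) + (n₂ - n₁) / 2 + max 1 (if i = 1 then d - (n₂ - n₁) / 2 else d)) else 0) else 0)) +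
          ((if i = 2 then (if min n₁ n₂ / 2 + d ≤ n₃ / 2 then ω * (x ^ (n₃ / 2 + min n₁ n₂ / 2 + 1) - x ^ (2 * (min n₁ n₂ / 2) + d)) else 0) else 0) +
            (if n₁ = n₂ ∧ n₁ < n₃ ∧ (n₃ - n₁) % 2 = 0 then εG 2 i * (if max 1 (if i = 2 then d - (n₃ - n₁) / 2 else d) ≤ (n₁ + 1) / 2 - d then
              x ^ (2 * (n₁ / 2) + (n₃ - n₁) / 2 + ((n₁ + 1) / 2 - d) + 1) - x ^ (2 * (n₁ / 2) + (n₃ - n₁) / 2 + max 1 (if i = 2 then d - (n₃ - n₁) / 2 else d)) else 0) else 0))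
      = (if n₁ = n₂ ∧ n₂ = n₃ then εH else if n₂ = n₃ then εG 0 i else if n₁ = n₃ then εG 1 i else εG 2 i) *
        (x ^ (k - (d + 1) / 2) - x ^ (k - max ((d + 1) / 2) (((![n₁, n₂, n₃] : Fin 3 → ℕ) i + 2 * (d % 2) + 2 - 3 * d) / 2))) := by
  have hm₁ : min n₁ (min n₂ n₃) ≤ n₁ := min_le_left _ _
  have hm₂ : min n₁ (min n₂ n₃) ≤ n₂ := le_trans (min_le_right _ _) (min_le_left _ _)
  have hm₃ : min n₁ (min n₂ n₃) ≤ n₃ := le_trans (min_le_right _ _) (min_le_right _ _)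
  rcases hiso with ⟨h12, h13⟩ | ⟨h13, h12⟩ | ⟨h23, h21⟩
  · subst h12
    rcases Nat.lt_or_ge n₁ n₃ with hlt | hge
    · exact kappa_arith_trunc_apex2 x ω εH εG hd hlt (le_trans hdn hm₁) h1 h3 hk hf1 hf3 i (fun hi h => hω2 hi rfl h)
    · have h : n₁ = n₃ := le_antisymm h13 hge
      subst h
      exact kappa_arith_trunc_equi x ω εH εG hd (le_trans hdn hm₁) h1 hk hf1 i
  · subst h13
    rcases Nat.lt_or_ge n₁ n₂ with hlt | hge
    · exact kappa_arith_trunc_apex1 x ω εH εG hd hlt (le_trans hdn hm₁) h1 h2 hk hf1 hf2 i (fun hi h => hω1 hi rfl h)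
    · have h : n₁ = n₂ := le_antisymm h12 hge
      subst h
      exact kappa_arith_trunc_equi x ω εH εG hd (le_trans hdn hm₁) h1 hk hf1 i
  · subst h23
    rcases Nat.lt_or_ge n₂ n₁ with hlt | hge
    · exact kappa_arith_trunc_apex0 x ω εH εG hd hlt (le_trans hdn hm₂) h2 h1 hk hf2 hf1 i (fun hi h => hω0 hi rfl h)
    · have h : n₂ = n₁ := le_antisymm h21 hge
      subst h
      exact kappa_arith_trunc_equi x ω εH εG hd (le_trans hdn hm₂) h2 hk hf2 i


end Tiling

end Summit.HodgeConjecture.HodgeConjecture.Cruxes.H413.F0P3cDyRamKappaCountBoxSumTruncatedTiling
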